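import Mathlib

/-!
# The shift parameter of a conjugation-symmetric character is conjugation-invariant
  (Lemma N5.L4(iii), the `a = 2` computation)

Lemma N5.L4(iii) of `route/TIER5.md` §N5.11.4, case `a = 2`: «the symmetry `ξ^{-1}(x̄) = ξ(x)`
(conjugate-symplectic) gives `ψ̄(γȳ) = ψ̄(−γy)` for all `y`, while `ψ̄(γȳ) = ψ̄(conj(γ̄ y)) =
ψ̄(−γ̄ y)`; so `ψ̄((γ − γ̄)y) = 1` for all `y` and `γ = γ̄ ∈ k_F^×`». Checked here for a
commutative ring `R` with an involution `σ` and a primitive additive character `ψ` with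
`ψ(σ z) = ψ(−z)` (the residue-level shape of «`ψ₀(x̄) = ψ₀(−x)`», `ψ₀ = ψ(tr(δ·))` with
`δ̄ = −δ`):

* `sigma_eq_self_of_symm`: if `ψ(γ · σ y) = ψ(γ y)⁻¹` for all `y`, then `σ γ = γ`;
* `mem_range_of_symm`: with «the fixed points of `σ` are the base field» as a hypothesis,
  `γ` lies in the base (the prose's «`γ = γ̄ ∈ k_F`»).

Declaration per README §8(d): «uses an L-value-free non-vanishing device: NO».
-/

namespace Summit.Ventures.HodgeRepro2.T5SymmetricShift

variable {R : Type*} [CommRing R]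

/-- If `ψ` is primitive with `ψ (σ z) = ψ (−z)` and the shifted character `y ↦ ψ(γ y)` is
conjugation-symmetric (`ψ(γ · σ y) = ψ(γ y)⁻¹`), then `σ γ = γ`. -/
theorem sigma_eq_self_of_symm (σ : R ≃+* R) (hinv : ∀ z, σ (σ z) = z) {ψ : AddChar R ℂ}
    (hψ : ψ.IsPrimitive) (hψσ : ∀ z, ψ (σ z) = ψ (-z)) {γ : R}
    (hγ : ∀ y, ψ (γ * σ y) = (ψ (γ * y))⁻¹) : σ γ = γ := by
  by_contra hne
  apply hψ (sub_ne_zero.2 hne)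
  ext y
  -- `ψ(γ σ y) = ψ(σ(σ γ · y)) = ψ(−σ γ · y)` and `ψ(γ σ y) = ψ(γ y)⁻¹ = ψ(−γ y)`
  have h1 : ψ (γ * σ y) = ψ (-(σ γ * y)) := by
    rw [← hψσ, map_mul σ, hinv]
  have h2 : ψ (γ * σ y) = ψ (-(γ * y)) := by
    rw [hγ, AddChar.map_neg_eq_inv]
  have h3 : ψ (-(σ γ * y)) = ψ (-(γ * y)) := h1.symm.trans h2
  rw [AddChar.mulShift_apply, AddChar.one_apply]
  have e : (σ γ - γ) * y = σ γ * y + -(γ * y) := by ring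
  rw [e, AddChar.map_add_eq_mul, ← h3, ← AddChar.map_add_eq_mul, add_neg_cancel,
    AddChar.map_zero_eq_one]

/-- With the fixed points of `σ` equal to the base field, the shift parameter of a
conjugation-symmetric character lies in the base: «`γ = γ̄ ∈ k_F`». -/
theorem mem_range_of_symm {F : Type*} [CommRing F] [Algebra F R] (σ : R ≃+* R)
    (hinv : ∀ z, σ (σ z) = z) (hfix : ∀ z, σ z = z → z ∈ Set.range (algebraMap F R))
    {ψ : AddChar R ℂ} (hψ : ψ.IsPrimitive) (hψσ : ∀ z, ψ (σ z) = ψ (-z)) {γ : R}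
    (hγ : ∀ y, ψ (γ * σ y) = (ψ (γ * y))⁻¹) : γ ∈ Set.range (algebraMap F R) :=
  hfix γ (sigma_eq_self_of_symm σ hinv hψ hψσ hγ)

end Summit.Ventures.HodgeRepro2.T5SymmetricShift
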